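import Literature.Analysis.FluidPDE.CollisionalTransferFunctional
import Literature.Analysis.FluidPDE.HardSphereDynamicsProofs
import Summits.AtomisticToContinuum.HydrodynamicLimit.Theorems.JParityClosureParityInBandEnergyTight
import Summits.AtomisticToContinuum.HydrodynamicLimit.Theorems.JParityClosureParityInBandSmoothTest
import Summits.AtomisticToContinuum.HydrodynamicLimit.Theorems.JParityClosureParityInBandFixedTime

/-!
# Route JParityClosure — `Assembly` (stmt-AtomisticToContinuum-17595): time-modulus of the
# empirical MOMENTUM field along hard-sphere trajectories

Helper toward `JParityClosure.Assembly` (≡ the closure crux `ParityBandClosure`, stmt-17608). The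
item concludes `TendstoHydroFieldsAt … t` at EVERY `t ∈ [0,T)`, while the route's engines identify the
fields only time-averaged; the upgrade lemma `tendsto_measure_fixedTime_of_timeAverage`
(`JParityClosureParityInBandFixedTime.lean`) consumes, per field, EQUICONTINUITY IN PROBABILITY of
`s ↦ X_N(s)` at `t`, uniformly in large `N`. This file supplies it for the momentum field:

* PATHWISE (`abs_momentumObservable_sub_le`; one trajectory `γ` on `𝕋ᵈ`, `C¹` vector field `J`,
  `a ≤ b`): `|Σᵢ⟪J(xᵢ(b)),vᵢ(b)⟫ − Σᵢ⟪J(xᵢ(a)),vᵢ(a)⟫| ≤ (b − a)‖DJ‖_∞ Σᵢ|vᵢ|² + ‖DJ‖_∞ ε ½𝒮(a,b]`,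
  `Σᵢ|vᵢ|² = 2·configEnergy` conserved, `𝒮(a,b] = Σ_{t_c∈(a,b]} Σ_{(i,j) colliding} |vᵢ⁺ − vᵢ⁻|` the
  windowed NORMAL-SPEED-JUMP functional (`collisionalTransferFunctional` with kernel
  `(i,j,z⁻,z⁺) ↦ |vᵢ⁺ − vᵢ⁻|`; at a collision `|vᵢ⁺ − vᵢ⁻| = ((w − v)·n̂)₊`, the trace `Σ_k Ξ_P^{kk}` of
  the `EvenStressEnskog` marks). Ingredients: the weak momentum balance law
  (`IsHardSphereTrajectory.sub_eq_integral_add_collisionalTransfer`), the kinetic-flux bound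
  `|Σᵢ⟪DJ(xᵢ)vᵢ,vᵢ⟫| ≤ ‖DJ‖_∞Σᵢ|vᵢ|²`, the pair form `⟪J(xᵢ) − J(xⱼ), Δvᵢ⟫` of the collisional jump
  (`|xᵢ − xⱼ|_𝕋 = ε`) and the torus mean-value inequality (`norm_sub_le_of_fderiv_le`).
* IN PROBABILITY (`hequi_momentum_of_energy_of_speedJump`, `hequi_momentum_localGibbs`): the `hequi`
  hypothesis of the upgrade lemma for `X_N(s) = (N+1)⁻¹Σᵢ⟪J(xᵢ(s)),vᵢ(s)⟫` from tightness of the kinetic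
  energy per particle (under the conjunct's `t = 0` LLN: `energy_tight_of_tendstoHydroFieldsAt_zero`) and
  a windowed bound in probability on `(ε_N/(N+1))·½𝒮(t,t+Δ]`; `tendsto_momentumObservable_fixedTime_localGibbs`
  runs the upgrade.

NOT here: the windowed speed-jump bound itself (in the route: `EvenStressEnskog` with window weights +
`DensityCap` + the packing guard), and the ENERGY field, whose modulus needs the cubic streaming current
and the collisional energy-transfer marks (gap G1 of the item's notes). No new objects.
-/

noncomputable section

namespace Summit.AtomisticToContinuum.HydrodynamicLimit.Theorems.JParityClosureMomentumModulus

open Set MeasureTheory Filter Topology Function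
open scoped ENNReal InnerProductSpace
open Literature.Analysis.FluidPDE Literature.Analysis.FunctionSpaces
open Literature.MathematicalPhysics.KineticTheory

variable {d : Type*} [Fintype d]

omit [Fintype d] in
/-- `Σᵢ |vᵢ|² = 2 · configEnergy`. [folklore] -/
theorem sum_norm_sq_eq_two_mul_configEnergy {X : Type*} [Fintype d] {N : ℕ} (z : Config N d X) :
    ∑ i, ‖(z i).2‖ ^ 2 = 2 * configEnergy z := by
  rw [configEnergy]; ring

/-- **Kinetic momentum-flux bound**: `|Σᵢ ⟪DJ(xᵢ) vᵢ, vᵢ⟫| ≤ ‖DJ‖_∞ · Σᵢ |vᵢ|² = ‖DJ‖_∞ · 2 E_kin`.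
[folklore] -/
theorem abs_momentumStreaming_le {N : ℕ} {J : UnitAddTorus d → EuclideanSpace ℝ d} {C : ℝ}
    (hC : ∀ x, ‖Torus.fderiv J x‖ ≤ C) (z : Config N d (UnitAddTorus d)) :
    |momentumStreaming J z| ≤ C * (2 * configEnergy z) := by
  rw [← sum_norm_sq_eq_two_mul_configEnergy, momentumStreaming, Finset.mul_sum]
  refine (Finset.abs_sum_le_sum_abs _ _).trans (Finset.sum_le_sum fun i _ => ?_)
  have h1 : ‖Torus.fderiv J (z i).1 (z i).2‖ ≤ C * ‖(z i).2‖ :=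
    (ContinuousLinearMap.le_opNorm _ _).trans (mul_le_mul_of_nonneg_right (hC _) (norm_nonneg _))
  calc |⟪Torus.fderiv J (z i).1 (z i).2, (z i).2⟫_ℝ|
        ≤ ‖Torus.fderiv J (z i).1 (z i).2‖ * ‖(z i).2‖ := abs_real_inner_le_norm _ _
    _ ≤ C * ‖(z i).2‖ * ‖(z i).2‖ := mul_le_mul_of_nonneg_right h1 (norm_nonneg _)
    _ = C * ‖(z i).2‖ ^ 2 := by ring

/-- **Torus mean-value inequality**: a `C¹` map `J : 𝕋ᵈ → F` with `‖DJ‖ ≤ C` is `C`-Lipschitz for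
the flat distance `|x − y|_𝕋 = ‖sepVec x y‖` (integrate `DJ` along `s ↦ y + proj (s • sepVec x y)`).
[folklore] -/
theorem norm_sub_le_of_fderiv_le {F : Type*} [NormedAddCommGroup F] [NormedSpace ℝ F]
    {J : UnitAddTorus d → F} (hJ : Torus.IsContDiff 1 J) {C : ℝ} (hC : ∀ x, ‖Torus.fderiv J x‖ ≤ C)
    (x y : UnitAddTorus d) :
    ‖J x - J y‖ ≤ C * ‖(Torus.geometry d).sepVec x y‖ := by
  set n : EuclideanSpace ℝ d := (Torus.geometry d).sepVec x y with hn
  have hxy : y + Torus.proj n = x := by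
    rw [hn, Torus.geometry_sepVec, Torus.proj_reprSym]
    abel
  have hf : ∀ s ∈ Icc (0 : ℝ) 1, HasDerivWithinAt (fun s : ℝ => J (y + Torus.proj (s • n)))
      (Torus.fderiv J (y + Torus.proj (s • n)) n) (Icc 0 1) s :=
    fun s _ => (Torus.hasDerivAt_apply_add_proj_smul hJ y n s).hasDerivWithinAt
  have hb : ∀ s ∈ Ico (0 : ℝ) 1, ‖Torus.fderiv J (y + Torus.proj (s • n)) n‖ ≤ C * ‖n‖ :=
    fun s _ => (ContinuousLinearMap.le_opNorm _ _).trans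
      (mul_le_mul_of_nonneg_right (hC _) (norm_nonneg _))
  have key := norm_image_sub_le_of_norm_deriv_le_segment_01' hf hb
  simpa only [one_smul, zero_smul, Torus.proj_zero, add_zero, hxy] using key

/-- A `C¹` map on the (compact) torus has bounded derivative: `∃ C ≥ 0, ‖DJ(x)‖ ≤ C`. [folklore] -/
theorem exists_fderiv_le {F : Type*} [NormedAddCommGroup F] [NormedSpace ℝ F]
    {J : UnitAddTorus d → F} (hJ : Torus.IsContDiff 1 J) :
    ∃ C : ℝ, 0 ≤ C ∧ ∀ x, ‖Torus.fderiv J x‖ ≤ C := by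
  obtain ⟨C, hC⟩ := isCompact_univ.exists_bound_of_continuousOn
    (Torus.continuous_fderiv hJ).continuousOn
  exact ⟨max C 0, le_max_right _ _, fun x => (hC x (mem_univ _)).trans (le_max_left _ _)⟩

/-- **The collisional momentum transfer is dominated by the speed-jump functional**: along a
hard-sphere trajectory on `𝕋ᵈ`, for `‖J x − J y‖ ≤ L |x − y|_𝕋`, the transfer over `(a, b]` (sum of
the jumps `⟪J(xᵢ) − J(xⱼ), Δvᵢ⟫`, `|xᵢ − xⱼ|_𝕋 = ε`) is at most `L · ε · ½ 𝒮(a, b]` (both orientations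
of the colliding pair carry `|Δvᵢ| = |Δvⱼ|`, whence the `½`). [folklore] -/
theorem abs_momentumTransfer_le {ε : ℝ} {N : ℕ} {γ : ℝ → Config N d (UnitAddTorus d)}
    (h : IsHardSphereTrajectory (Torus.geometry d) ε N γ)
    {J : UnitAddTorus d → EuclideanSpace ℝ d} {L : ℝ}
    (hL : ∀ x y, ‖J x - J y‖ ≤ L * ‖(Torus.geometry d).sepVec x y‖) (a b : ℝ) :
    |collisionalTransfer (Torus.geometry d) ε (momentumObservable J) γ a b| ≤
      L * ε * (2⁻¹ * collisionalTransferFunctional (Torus.geometry d) ε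
        (fun i _ pre post => ‖(post i).2 - (pre i).2‖) γ a b) := by
  have hG : ∀ x : UnitAddTorus d, Continuous ((Torus.geometry d).translate x) := fun x =>
    continuous_const.add Torus.continuous_proj
  have hfin := h.finite_collisionTimes_inter_Ioc a b
  rw [collisionalTransfer_eq_sum _ hfin, collisionalTransferFunctional_eq_sum _ hfin,
    Finset.mul_sum, Finset.mul_sum]
  refine (Finset.abs_sum_le_sum_abs _ _).trans (Finset.sum_le_sum fun t ht => ?_)
  obtain ⟨i, j, hij, hc⟩ := mem_collisionTimes.1 (hfin.mem_toFinset.1 ht).1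
  rw [h.sum_collidingPairs_eq hij hc, h.collisionJump_momentumObservable hG J hij hc]
  have hvj : ‖(γ t j).2 - (leftLim γ t j).2‖ = ‖(γ t i).2 - (leftLim γ t i).2‖ := by
    rw [h.vel_sub_leftLim_right_eq_neg hij hc, norm_neg]
  have hε : ‖(Torus.geometry d).sepVec (γ t i).1 (γ t j).1‖ = ε := (mem_contactSet.1 hc).2
  rw [hvj]
  calc |⟪J (γ t i).1 - J (γ t j).1, (γ t i).2 - (leftLim γ t i).2⟫_ℝ|
        ≤ ‖J (γ t i).1 - J (γ t j).1‖ * ‖(γ t i).2 - (leftLim γ t i).2‖ :=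
          abs_real_inner_le_norm _ _
    _ ≤ L * ε * ‖(γ t i).2 - (leftLim γ t i).2‖ := by
          refine mul_le_mul_of_nonneg_right ?_ (norm_nonneg _)
          rw [← hε]
          exact hL _ _
    _ = L * ε * (2⁻¹ * (‖(γ t i).2 - (leftLim γ t i).2‖ + ‖(γ t i).2 - (leftLim γ t i).2‖)) := by
          ring

/-- The speed-jump functional (indeed any collision-indexed functional with a nonnegative kernel) is
nonnegative. [folklore] -/
theorem collisionalTransferFunctional_nonneg {X : Type*} [TopologicalSpace X] {G : Geometry d X}
    {ε : ℝ} {N : ℕ} {g : Fin N → Fin N → Config N d X → Config N d X → ℝ}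
    (hg : ∀ i j pre post, 0 ≤ g i j pre post) (γ : ℝ → Config N d X) (a b : ℝ) :
    0 ≤ collisionalTransferFunctional G ε g γ a b := by
  rw [collisionalTransferFunctional]
  exact finsum_nonneg fun t => finsum_nonneg fun _ => Finset.sum_nonneg fun p _ => hg _ _ _ _

/-- A collision-indexed functional with a nonnegative kernel is monotone in the right end of the
window (along a hard-sphere trajectory, where the sums are finite). [folklore] -/
theorem collisionalTransferFunctional_mono_right {X : Type*} [TopologicalSpace X] {G : Geometry d X}
    {ε : ℝ} {N : ℕ} {γ : ℝ → Config N d X} (h : IsHardSphereTrajectory G ε N γ)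
    {g : Fin N → Fin N → Config N d X → Config N d X → ℝ}
    (hg : ∀ i j pre post, 0 ≤ g i j pre post) {a b c : ℝ} (hab : a ≤ b) (hbc : b ≤ c) :
    collisionalTransferFunctional G ε g γ a b ≤ collisionalTransferFunctional G ε g γ a c := by
  rw [← h.collisionalTransferFunctional_add_adjacent g hab hbc]
  exact le_add_of_nonneg_right (collisionalTransferFunctional_nonneg hg γ b c)

/-- **Time-modulus of the momentum observable along a hard-sphere trajectory** (`𝕋ᵈ`, `C¹` field
`J`, `‖DJ‖ ≤ C`, `a ≤ b`): `|M_J(γ b) − M_J(γ a)| ≤ (b − a) · C · 2E_kin(γ a) + C · ε · ½ 𝒮(a, b]`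
(weak momentum balance law + kinetic-flux bound with conservation of `E_kin` +
`abs_momentumTransfer_le` with the mean-value inequality). [folklore] -/
theorem abs_momentumObservable_sub_le {ε : ℝ} {N : ℕ} {γ : ℝ → Config N d (UnitAddTorus d)}
    (h : IsHardSphereTrajectory (Torus.geometry d) ε N γ)
    {J : UnitAddTorus d → EuclideanSpace ℝ d} (hJ : Torus.IsContDiff 1 J) {C : ℝ}
    (hC : ∀ x, ‖Torus.fderiv J x‖ ≤ C) {a b : ℝ} (hab : a ≤ b) :
    |momentumObservable J (γ b) - momentumObservable J (γ a)| ≤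
      (b - a) * (C * (2 * configEnergy (γ a))) +
        C * ε * (2⁻¹ * collisionalTransferFunctional (Torus.geometry d) ε
          (fun i _ pre post => ‖(post i).2 - (pre i).2‖) γ a b) := by
  have hG : ∀ x : UnitAddTorus d, Continuous ((Torus.geometry d).translate x) := fun x =>
    continuous_const.add Torus.continuous_proj
  obtain ⟨-, heq⟩ := h.sub_eq_integral_add_collisionalTransfer hG
    (hasDerivAt_momentumObservable_freeFlight hJ)
    (fun z => (continuous_momentumStreaming hJ).comp
      (continuous_freeFlight_of_continuous_translate hG z)) hab
  rw [heq]
  refine (abs_add_le _ _).trans (add_le_add ?_ (abs_momentumTransfer_le h (norm_sub_le_of_fderiv_le hJ hC) a b))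
  have hbd : ∀ s ∈ Set.uIoc a b, ‖momentumStreaming J (γ s)‖ ≤ C * (2 * configEnergy (γ a)) := by
    intro s _
    rw [Real.norm_eq_abs, IsHardSphereTrajectory.configEnergy_eq_holds h a s]
    exact abs_momentumStreaming_le hC _
  have key := intervalIntegral.norm_integral_le_of_norm_le_const hbd
  rw [Real.norm_eq_abs, abs_of_nonneg (sub_nonneg.2 hab)] at key
  linarith

/-- **Time-modulus of the momentum observable along a hard-sphere flow** (good datum `z`, times
`t ≤ s`, energy read at time `0`):
`|M_J(Φ_s z) − M_J(Φ_t z)| ≤ (s − t) · C · 2E_kin(z) + C · ε · ½ 𝒮_z(t, s]`. [folklore] -/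
theorem abs_momentumObservable_flow_sub_le {ε : ℝ} {N : ℕ}
    (Φ : HardSphereFlow (Torus.geometry d) ε N) {z : Config N d (UnitAddTorus d)} (hz : z ∈ Φ.good)
    {J : UnitAddTorus d → EuclideanSpace ℝ d} (hJ : Torus.IsContDiff 1 J) {C : ℝ}
    (hC : ∀ x, ‖Torus.fderiv J x‖ ≤ C) {t s : ℝ} (hts : t ≤ s) :
    |momentumObservable J (Φ.flow s z) - momentumObservable J (Φ.flow t z)| ≤
      (s - t) * (C * (2 * configEnergy z)) +
        C * ε * (2⁻¹ * collisionalTransferFunctional (Torus.geometry d) ε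
          (fun i _ pre post => ‖(post i).2 - (pre i).2‖) (fun r => Φ.flow r z) t s) := by
  have htraj := Φ.isTrajectory z hz
  have key := abs_momentumObservable_sub_le htraj hJ hC hts
  have hE : configEnergy (Φ.flow t z) = configEnergy z := by
    rw [IsHardSphereTrajectory.configEnergy_eq_holds htraj t 0]
    exact congrArg configEnergy (Φ.flow_zero z hz)
  rwa [hE] at key

/-! ### In probability: the equicontinuity input of the fixed-time upgrade -/

/-- **From the pathwise modulus to deviation probabilities**: for a law `P` not charging the bad
set, `‖DJ‖ ≤ C`, `0 ≤ C`, `0 ≤ ε`, `t ≤ s ≤ u`, a normalisation `m > 0` and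
`(s − t) · 2CK + C · η ≤ δ`:
`P{δ < |m⁻¹ M_J(Φ_s z) − m⁻¹ M_J(Φ_t z)|} ≤ P{K < m⁻¹ E_kin(z)} + P{η < ε m⁻¹ · ½ 𝒮_z(t, u]}`.
[folklore] -/
theorem measure_setOf_lt_abs_sub_le {ε : ℝ} {N : ℕ}
    (Φ : HardSphereFlow (Torus.geometry d) ε N) (P : Measure (Config N d (UnitAddTorus d)))
    (hP : P Φ.goodᶜ = 0)
    {J : UnitAddTorus d → EuclideanSpace ℝ d} (hJ : Torus.IsContDiff 1 J) {C : ℝ}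
    (hC : ∀ x, ‖Torus.fderiv J x‖ ≤ C) (hC0 : 0 ≤ C) (hε : 0 ≤ ε)
    {t s u : ℝ} (hts : t ≤ s) (hsu : s ≤ u) {m K η δ : ℝ} (hm : 0 < m)
    (hδ : (s - t) * (2 * C * K) + C * η ≤ δ) :
    P {z | δ < |m⁻¹ * momentumObservable J (Φ.flow s z) - m⁻¹ * momentumObservable J (Φ.flow t z)|} ≤
      P {z | K < m⁻¹ * configEnergy z} +
        P {z | η < ε * m⁻¹ * (2⁻¹ * collisionalTransferFunctional (Torus.geometry d) ε
          (fun i _ pre post => ‖(post i).2 - (pre i).2‖) (fun r => Φ.flow r z) t u)} := by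
  set A : Set (Config N d (UnitAddTorus d)) := {z | K < m⁻¹ * configEnergy z} with hA
  set B : Set (Config N d (UnitAddTorus d)) := {z | η < ε * m⁻¹ * (2⁻¹ *
    collisionalTransferFunctional (Torus.geometry d) ε (fun i _ pre post => ‖(post i).2 - (pre i).2‖)
      (fun r => Φ.flow r z) t u)} with hB
  have hsub : {z | δ < |m⁻¹ * momentumObservable J (Φ.flow s z) -
      m⁻¹ * momentumObservable J (Φ.flow t z)|} ⊆ Φ.goodᶜ ∪ (A ∪ B) := by
    intro z hz
    rw [mem_setOf_eq] at hz
    by_contra hcon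
    simp only [hA, hB, mem_union, mem_compl_iff, mem_setOf_eq, not_or, not_not, not_lt] at hcon
    obtain ⟨hzg, hK, hη⟩ := hcon
    set Sts := collisionalTransferFunctional (Torus.geometry d) ε
      (fun i _ pre post => ‖(post i).2 - (pre i).2‖) (fun r => Φ.flow r z) t s with hSts
    set Stu := collisionalTransferFunctional (Torus.geometry d) ε
      (fun i _ pre post => ‖(post i).2 - (pre i).2‖) (fun r => Φ.flow r z) t u with hStu
    have key := abs_momentumObservable_flow_sub_le Φ hzg hJ hC hts
    have hmono : Sts ≤ Stu :=
      collisionalTransferFunctional_mono_right (Φ.isTrajectory z hzg)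
        (fun _ _ _ _ => norm_nonneg _) hts hsu
    have habs : |m⁻¹ * momentumObservable J (Φ.flow s z) - m⁻¹ * momentumObservable J (Φ.flow t z)| =
        m⁻¹ * |momentumObservable J (Φ.flow s z) - momentumObservable J (Φ.flow t z)| := by
      rw [← mul_sub, abs_mul, abs_of_pos (inv_pos.2 hm)]
    rw [habs] at hz
    have h1 : m⁻¹ * |momentumObservable J (Φ.flow s z) - momentumObservable J (Φ.flow t z)| ≤
        (s - t) * (2 * C * (m⁻¹ * configEnergy z)) + C * (ε * m⁻¹ * (2⁻¹ * Sts)) := by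
      have := mul_le_mul_of_nonneg_left key (inv_pos.2 hm).le
      calc _ ≤ _ := this
        _ = _ := by rw [hSts]; ring
    have h2 : (s - t) * (2 * C * (m⁻¹ * configEnergy z)) ≤ (s - t) * (2 * C * K) :=
      mul_le_mul_of_nonneg_left (mul_le_mul_of_nonneg_left hK (by positivity)) (sub_nonneg.2 hts)
    have h3 : C * (ε * m⁻¹ * (2⁻¹ * Sts)) ≤ C * η := by
      refine mul_le_mul_of_nonneg_left (le_trans ?_ hη) hC0
      have hεm : 0 ≤ ε * m⁻¹ := mul_nonneg hε (inv_pos.2 hm).le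
      nlinarith
    linarith
  calc P {z | δ < |m⁻¹ * momentumObservable J (Φ.flow s z) -
          m⁻¹ * momentumObservable J (Φ.flow t z)|}
      ≤ P (Φ.goodᶜ ∪ (A ∪ B)) := measure_mono hsub
    _ ≤ P Φ.goodᶜ + P (A ∪ B) := measure_union_le _ _
    _ ≤ P Φ.goodᶜ + (P A + P B) := by
        gcongr
        exact measure_union_le _ _
    _ = P A + P B := by rw [hP, zero_add]

/-- **Equicontinuity in probability of the normalised momentum observable** — the hypothesis
`hequi` of `tendsto_measure_fixedTime_of_timeAverage` for `X_N(s) = (N+1)⁻¹ Σᵢ ⟪J(xᵢ(s)), vᵢ(s)⟫` —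
from (i) tightness of the kinetic energy per particle and (ii) a windowed bound in probability on
the normalised speed-jump statistic `(ε_N/(N+1)) · ½ 𝒮(t, t+Δ]` (laws not charging the bad sets,
diameters `ε N ≥ 0`, any `C¹` test field). [folklore] -/
theorem hequi_momentum_of_energy_of_speedJump {εN : ℕ → ℝ} (hε : ∀ N, 0 ≤ εN N)
    (P : ∀ N : ℕ, Measure (Config (N + 1) d (UnitAddTorus d)))
    (Φ : ∀ N : ℕ, HardSphereFlow (Torus.geometry d) (εN N) (N + 1))
    (hgood : ∀ N, P N (Φ N).goodᶜ = 0)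
    {J : UnitAddTorus d → EuclideanSpace ℝ d} (hJ : Torus.IsContDiff 1 J) (t : ℝ) {Δ₀ : ℝ}
    (hΔ₀ : 0 < Δ₀)
    (henergy : ∀ κ : ℝ, 0 < κ → ∃ K : ℝ, ∃ N₁ : ℕ, ∀ N, N₁ ≤ N →
      P N {z | K < ((N : ℝ) + 1)⁻¹ * configEnergy z} ≤ ENNReal.ofReal κ)
    (hstat : ∀ η : ℝ, 0 < η → ∀ κ : ℝ, 0 < κ → ∃ Δ : ℝ, 0 < Δ ∧ ∃ N₂ : ℕ, ∀ N, N₂ ≤ N →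
      P N {z | η < εN N * ((N : ℝ) + 1)⁻¹ * (2⁻¹ *
        collisionalTransferFunctional (Torus.geometry d) (εN N)
          (fun i _ pre post => ‖(post i).2 - (pre i).2‖) (fun r => (Φ N).flow r z) t (t + Δ))} ≤
        ENNReal.ofReal κ) :
    ∀ δ : ℝ, 0 < δ → ∀ κ : ℝ, 0 < κ → ∃ Δ : ℝ, 0 < Δ ∧ Δ ≤ Δ₀ ∧ ∃ N₀ : ℕ, ∀ N, N₀ ≤ N →
      ∀ s ∈ Ioo t (t + Δ),
        P N {z | δ < |((N : ℝ) + 1)⁻¹ * momentumObservable J ((Φ N).flow s z) -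
          ((N : ℝ) + 1)⁻¹ * momentumObservable J ((Φ N).flow t z)|} ≤ ENNReal.ofReal κ := by
  intro δ hδ κ hκ
  obtain ⟨C, hC0, hC⟩ := exists_fderiv_le hJ
  obtain ⟨K, N₁, hK⟩ := henergy (κ / 2) (by positivity)
  set K' : ℝ := max K 1 with hK'def
  have hK'pos : 0 < K' := lt_of_lt_of_le one_pos (le_max_right _ _)
  set η : ℝ := δ / (2 * (C + 1)) with hηdef
  have hη : 0 < η := by positivity
  obtain ⟨Δ, hΔ, N₂, hS⟩ := hstat η hη (κ / 2) (by positivity)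
  have hden : 0 < 4 * C * K' + 4 := by positivity
  set Δ' : ℝ := min (min Δ Δ₀) (δ / (4 * C * K' + 4)) with hΔ'def
  have hΔ'pos : 0 < Δ' := lt_min (lt_min hΔ hΔ₀) (div_pos hδ hden)
  refine ⟨Δ', hΔ'pos, (min_le_left _ _).trans (min_le_right _ _), max N₁ N₂, fun N hN s hs => ?_⟩
  have hts : t ≤ s := hs.1.le
  have hsu : s ≤ t + Δ := by linarith [hs.2, ((min_le_left _ _).trans (min_le_left _ _) : Δ' ≤ Δ)]
  have harith : (s - t) * (2 * C * K') + C * η ≤ δ := by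
    have h1 : s - t ≤ δ / (4 * C * K' + 4) := by linarith [hs.2, min_le_right (min Δ Δ₀) (δ / (4 * C * K' + 4))]
    have h2 : (s - t) * (2 * C * K') ≤ δ / 2 := by
      have hCK : 0 ≤ 2 * C * K' := by positivity
      calc (s - t) * (2 * C * K') ≤ δ / (4 * C * K' + 4) * (2 * C * K') :=
            mul_le_mul_of_nonneg_right h1 hCK
        _ ≤ δ / 2 := by
            rw [div_mul_eq_mul_div, div_le_div_iff₀ hden two_pos]
            nlinarith
    have h3 : C * η ≤ δ / 2 := by
      rw [hηdef, ← mul_div_assoc, div_le_div_iff₀ (by positivity) two_pos]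
      nlinarith
    linarith
  have hm : (0 : ℝ) < (N : ℝ) + 1 := by positivity
  calc P N {z | δ < |((N : ℝ) + 1)⁻¹ * momentumObservable J ((Φ N).flow s z) -
          ((N : ℝ) + 1)⁻¹ * momentumObservable J ((Φ N).flow t z)|}
      ≤ P N {z | K' < ((N : ℝ) + 1)⁻¹ * configEnergy z} +
          P N {z | η < εN N * ((N : ℝ) + 1)⁻¹ * (2⁻¹ *
            collisionalTransferFunctional (Torus.geometry d) (εN N)
              (fun i _ pre post => ‖(post i).2 - (pre i).2‖) (fun r => (Φ N).flow r z) t (t + Δ))} :=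
        measure_setOf_lt_abs_sub_le (Φ N) (P N) (hgood N) hJ hC hC0 (hε N) hts hsu hm harith
    _ ≤ ENNReal.ofReal (κ / 2) + ENNReal.ofReal (κ / 2) :=
        add_le_add ((measure_mono fun z hz => lt_of_le_of_lt (le_max_left K 1) hz).trans
          (hK N (le_of_max_le_left hN))) (hS N (le_of_max_le_right hN))
    _ = ENNReal.ofReal κ := by
        rw [← ENNReal.ofReal_add (by positivity) (by positivity), add_halves]

/-- The momentum field of the conjunct in the vocabulary of this file: for every fixed vector `e`,
`⟪e, empiricalMomentumField z χ⟫ = N⁻¹ · Σᵢ ⟪χ(xᵢ) e, vᵢ⟫ = N⁻¹ · momentumObservable (χ • e) z`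
(so the components of the empirical momentum field are normalised momentum observables of the
`C¹` vector fields `x ↦ χ(x) e_k`). [folklore] -/
theorem inner_empiricalMomentumField {N : ℕ} (z : Config N (Fin 3) T3) (χ : T3 → ℝ) (e : V3) :
    ⟪e, empiricalMomentumField z χ⟫_ℝ = (N : ℝ)⁻¹ * momentumObservable (fun x => χ x • e) z := by
  rw [empiricalMomentumField, integral_empiricalMeasure_vec, inner_smul_right, inner_sum,
    momentumObservable, Finset.mul_sum, Finset.mul_sum]
  refine Finset.sum_congr rfl fun i _ => ?_
  rw [inner_smul_right, real_inner_smul_left, real_inner_comm]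

/-- **The momentum input of the fixed-time upgrade under the conjunct's hypotheses** (`σ > 0`,
local Gibbs laws, the `t = 0` LLN `TendstoHydroFieldsAt … 0`; any `C¹` field `J`, any `t`): IF small
windows after `t` carry small normalised speed-jump statistic `(ε_N/(N+1)) · ½ 𝒮(t, t+Δ]` in
probability, uniformly in large `N` (`hstat`; in the route the business of `EvenStressEnskog` with
window weights, `DensityCap` and the packing guard), THEN `s ↦ (N+1)⁻¹ Σᵢ ⟪J(xᵢ(s)), vᵢ(s)⟫` satisfies
verbatim the hypothesis `hequi` of `tendsto_measure_fixedTime_of_timeAverage` (energy tightness: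
`energy_tight_of_tendstoHydroFieldsAt_zero`; null bad sets: `localGibbsLaw_compl_good`). [folklore] -/
theorem hequi_momentum_localGibbs {σ : ℝ} (hσ : 0 < σ) (a₀ θ₀ : T3 → ℝ) (u₀ : T3 → V3)
    (Φ : (N : ℕ) → HardSphereFlow (Torus.geometry (Fin 3)) (hsDiameter σ N) (N + 1))
    (ρ θ : ℝ → T3 → ℝ) (u : ℝ → T3 → V3)
    (h0 : TendstoHydroFieldsAt (fun N => localGibbsLaw σ a₀ u₀ θ₀ N (Φ N)) Φ ρ u θ 0)
    {J : T3 → V3} (hJ : Torus.IsContDiff 1 J) (t : ℝ) {Δ₀ : ℝ} (hΔ₀ : 0 < Δ₀)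
    (hstat : ∀ η : ℝ, 0 < η → ∀ κ : ℝ, 0 < κ → ∃ Δ : ℝ, 0 < Δ ∧ ∃ N₂ : ℕ, ∀ N, N₂ ≤ N →
      localGibbsLaw σ a₀ u₀ θ₀ N (Φ N) {z | η < hsDiameter σ N * ((N : ℝ) + 1)⁻¹ * (2⁻¹ *
        collisionalTransferFunctional (Torus.geometry (Fin 3)) (hsDiameter σ N)
          (fun i _ pre post => ‖(post i).2 - (pre i).2‖) (fun r => (Φ N).flow r z) t (t + Δ))} ≤
        ENNReal.ofReal κ) :
    ∀ δ : ℝ, 0 < δ → ∀ κ : ℝ, 0 < κ → ∃ Δ : ℝ, 0 < Δ ∧ Δ ≤ Δ₀ ∧ ∃ N₀ : ℕ, ∀ N, N₀ ≤ N →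
      ∀ s ∈ Ioo t (t + Δ),
        localGibbsLaw σ a₀ u₀ θ₀ N (Φ N)
          {z | δ < |((N : ℝ) + 1)⁻¹ * momentumObservable J ((Φ N).flow s z) -
            ((N : ℝ) + 1)⁻¹ * momentumObservable J ((Φ N).flow t z)|} ≤ ENNReal.ofReal κ := by
  refine hequi_momentum_of_energy_of_speedJump (fun N => (hsDiameter_pos hσ N).le)
    (fun N => localGibbsLaw σ a₀ u₀ θ₀ N (Φ N)) Φ
    (fun N => localGibbsLaw_compl_good σ a₀ θ₀ u₀ N (Φ N)) hJ t hΔ₀ (fun κ hκ => ?_) hstat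
  obtain ⟨K, N₁, hK⟩ := energy_tight_of_tendstoHydroFieldsAt_zero σ a₀ θ₀ u₀ Φ ρ θ u h0 0 κ hκ
  refine ⟨K, N₁, fun N hN => le_trans (measure_mono fun z hz => ?_)
    ((measure_union_le ((Φ N).goodᶜ) {z | K < empiricalEnergyField ((Φ N).flow 0 z) fun _ => 1}).trans
      ?_)⟩
  · simp only [mem_setOf_eq, mem_union, mem_compl_iff] at hz ⊢
    by_cases hg : z ∈ (Φ N).good
    · right
      rw [(Φ N).flow_zero z hg, empiricalEnergyField_one_eq]
      simpa [Nat.cast_add_one] using hz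
    · exact Or.inl hg
  · rw [localGibbsLaw_compl_good, zero_add]
    exact hK N hN

/-- **The momentum observable at a FIXED instant from its time averages**: if, near `t`, the
normalised momentum observable converges to `G` (continuous at `t`) IN MEASURE IN TIME (`havg`, what a
Young-measure / Březina–Feireisl identification delivers) and small windows carry small speed-jump
statistic (`hstat`), then it converges in probability AT `t`. With `J = χ e_k` and
`inner_empiricalMomentumField`: the `k`-th component of the momentum conjunct of
`TendstoHydroFieldsAt … t`. [folklore] -/
theorem tendsto_momentumObservable_fixedTime_localGibbs {σ : ℝ} (hσ : 0 < σ) (a₀ θ₀ : T3 → ℝ)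
    (u₀ : T3 → V3)
    (Φ : (N : ℕ) → HardSphereFlow (Torus.geometry (Fin 3)) (hsDiameter σ N) (N + 1))
    (ρ θ : ℝ → T3 → ℝ) (u : ℝ → T3 → V3)
    (h0 : TendstoHydroFieldsAt (fun N => localGibbsLaw σ a₀ u₀ θ₀ N (Φ N)) Φ ρ u θ 0)
    {J : T3 → V3} (hJ : Torus.IsContDiff 1 J) (t : ℝ) {Δ₀ : ℝ} (hΔ₀ : 0 < Δ₀)
    (G : ℝ → ℝ) (hG : ContinuousAt G t)
    (havg : ∀ δ : ℝ, 0 < δ → Tendsto (fun N => ∫⁻ s in Ioo t (t + Δ₀),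
      localGibbsLaw σ a₀ u₀ θ₀ N (Φ N)
        {z | δ < |((N : ℝ) + 1)⁻¹ * momentumObservable J ((Φ N).flow s z) - G s|}) atTop (𝓝 0))
    (hstat : ∀ η : ℝ, 0 < η → ∀ κ : ℝ, 0 < κ → ∃ Δ : ℝ, 0 < Δ ∧ ∃ N₂ : ℕ, ∀ N, N₂ ≤ N →
      localGibbsLaw σ a₀ u₀ θ₀ N (Φ N) {z | η < hsDiameter σ N * ((N : ℝ) + 1)⁻¹ * (2⁻¹ *
        collisionalTransferFunctional (Torus.geometry (Fin 3)) (hsDiameter σ N)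
          (fun i _ pre post => ‖(post i).2 - (pre i).2‖) (fun r => (Φ N).flow r z) t (t + Δ))} ≤
        ENNReal.ofReal κ) :
    ∀ δ : ℝ, 0 < δ → Tendsto (fun N => localGibbsLaw σ a₀ u₀ θ₀ N (Φ N)
      {z | δ < |((N : ℝ) + 1)⁻¹ * momentumObservable J ((Φ N).flow t z) - G t|}) atTop (𝓝 0) :=
  tendsto_measure_fixedTime_of_timeAverage (fun N => localGibbsLaw σ a₀ u₀ θ₀ N (Φ N))
    (fun N s z => ((N : ℝ) + 1)⁻¹ * momentumObservable J ((Φ N).flow s z)) G hG havg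
    (hequi_momentum_localGibbs hσ a₀ θ₀ u₀ Φ ρ θ u h0 hJ t hΔ₀ hstat)

end Summit.AtomisticToContinuum.HydrodynamicLimit.Theorems.JParityClosureMomentumModulus

end
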